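import Summits.QuantumFields.BalabanUV.Beta.D1BFx.LamSectorUnfold

/-!
# `BalabanUV.Beta.D1BFx.LamSectorUnfoldGen` — road «BF-x» for binder row D1, slot (K), census group **G_Λ**, «S-GEN-LAM» FILE 1 (ruling ρ-g15-2 (iii)):
# `LamSectorUnfold` RE-STATED FOR A GENERIC Λ-SECTOR — arbitrary multiplier-response weights `Λc` and arbitrary averaging ff-Hessian tables `H`
# under their two LETTERS (weight decay from the fine bond; bi-localisation of the tables at their coarse bond)

HONEST DEPENDENCY (page 1, mandatory): continuum YM on T⁴ ⇐ BetaPertH ∧ nine spine estimates (0/9 proved); BetaPertH ⇐ (D1) ∧ (D4) ∧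
CAP+tail; G-an2-4 gates asym, D1 and NE2/3/4.  HONEST FRAMING (cell contract, verbatim): «discharging `BetaPertH` makes Bałaban's UV
stability UNCONDITIONAL — a real constructive-QFT result; it is NOT the continuum limit and NOT the Clay problem.»  THIS MODULE DISCHARGES
NOTHING of the wall: [folklore] `tsum`∕Fubini bookkeeping BY NAME — the proofs of gan24-leaf-05 g40's `LamSectorUnfold` (p-landed) with its two
Λ-specific inputs (`exists_abs_lamCoeff_KInv_le` = the weight bound of the STRAIGHT one-shot multiplier response `lamCoeffOf (KInv n) n`, and
`AveragingHessianKernels.biLoc_hessFF` = the localisation of the STRAIGHT averaging's ff-Hessian `hessFF n`) REPLACED by displayed hypotheses on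
free data `Λc`, `H`.  No definition, no `def … : Prop`, nothing cited, no printed statement used, 0 sorry.  0 wall binders; (K) NOT closed; NOT D1,
NOT `BetaPertH`, NOT continuum, NOT Clay.

ABSOLUTE RULE (cell charter, verbatim): «No internally-minted statement may enter as a cited fact. Every hypothesis is either kernel-proved in
this package or a verbatim quotation of a PUBLISHED theorem with page reference. The manuscript(s) under audit are NOT citable for their own
disputed steps — they are the thing under adjudication; programme-internal (2001/route/tribunal) claims are never citable.»

WHY (owner ruling ρ-g15-2, journal [D1P2-G15-RULING-1]; `DICT-CHAIN-SPEC.md` §6 R-g14-1).  The road's gluon slot `TOfRed n a S W` is generic in the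
first-jet pack `S`; of `SbfBal`'s three ff-sectors only the LAGRANGE sector `SbL n = ffOf ∘ SLam n (lamCoeffOf (KInv n) n) (hessFF n)` names the
straight one-shot system's multiplier response and averaging Hessian, which the (0.4)-symmetrised composite pack of the spine's literal replaces by
its own (Q-JC-1′ (c)).  `InterLevelTransport.SLam n Λc H` is ALREADY generic in the weights `Λc` and the tables `H`; this file re-proves
`LamSectorUnfold` §2–§3 for `ffOf (SLam n Λc H κ u)` under
  (WΛ) `hΛ : ∀ m y κ u, |Λc m y κ u| ≤ CΛ · e^{−δ·|n•y − u|₁}`   (weight decay from the fine bond; `0 ≤ CΛ`, `0 < δ`),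
  (LH) `hH : ∀ m y, BiLoc (ffOf (H m y)) (n•y) (n•y) CH δ`        (the tables' ff-blocks bi-localised at their coarse bond),
so that the Λ family (`LamDictionary`, `LamPartnerLetters`, `LamPartnerZero`, `RoadEndLamRow`) can be re-instantiated on any pack whose Λ-sector has
this shape.  INSTANCES: the landed file IS the instance `Λc := lamCoeffOf (KInv n) n`, `H := hessFF n` ((WΛ) = `exists_abs_lamCoeff_KInv_le`, (LH) =
`biLoc_ffOf ∘ biLoc_hessFF`; `LamSectorUnfold.bubble_SbL_left = bubble_SLam_left n hGa hC hδ hw hY hZ κ u` — the gate's `dedup.landed` lint forbids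
re-stating it here, which is the check); the composite instance waits for road FP's letters (Q-JC-1′).

CONTENT ([folklore]; `G := Ga n a`; `Y m y := ffOf (H m y)`).
* §1 `ffOf_SLam_eq_neg_sum_wsum` (the generic Λ-sector as a kernel: `ffOf (SLam n Λc H κ u) = −Σ_m wsum (onLat n (Λc m · κ u)) (onLat n (Y m ·))`),
  `loc_wsum_onLat_gen` (each `m`-term localised under (WΛ)(LH)).
* §2 **`bubble_SLam_left`** ∕ **`bubble_SLam_right`**: `bubble G (ffOf (SLam n Λc H κ u)) Z = −Σ_m Σ'_y Λc m y κ u · bubble G (Y m y) Z` and the mirror.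
* §3 **`tadpole_lamTable_eq_gen`**: `LamSectorUnfold.tadpole_lamTable_eq` with `lamCoeffOf (KInv n) n ↦ Λc` under (WΛ) (the Λ₂-slot structure, the
  companion tables `TΛ` and the antisymmetric `WA` displayed exactly as there).
Unit `b2b-balaban-beta-d1-p2` gen 15 (road «BF-x» OWNER), «S-GEN-LAM» file 1 of 5; no existing file touched.
-/

noncomputable section

namespace Summit.QuantumFields.BalabanUV.Beta.D1BFx.LamSectorUnfoldGen

open Finset
open scoped BigOperators
open Literature.Probability.LatticeModels (Torus.proj)
open Literature.MathematicalPhysics.QuantumFieldTheory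
open Literature.MathematicalPhysics.QuantumFieldTheory.Balaban1983to89
open Literature.MathematicalPhysics.QuantumFieldTheory.Balaban1983to89.Beta
open LatticeForm (quo)
open B12Sec2to5 (l1 l1_nonneg)
open ExpKernelCalculus (Site MKer Decays BiLoc bubble tadpole summable_exp_shift')
open OneStepResolventKernel (Fib KInv wsum biLoc_wsum decays_KInv quo_zsmul eq_zsmul_quo_of_proj)
open InterLevelTransport (onLat onLat_zsmul onLat_off SLam cwsum)
open BalabanStepJets (lamCoeffOf abs_lamCoeffOf_le)
open AveragingHessianKernels (hessFF biLoc_hessFF)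
open Summit.QuantumFields.BalabanUV.Beta.TameKernelCalculus (Spr Loc trK tadpole_add biLoc_of_le)
open Summit.QuantumFields.BalabanUV.Beta.KernelWardRelative (bubble_finset_sum_left loc_finset_sum tadpole_finset_sum)
open KernelReflection (bubble_smul_left bubble_smul_right)
open Summit.QuantumFields.BalabanUV.Beta.D1BFx.DressedBubbleBridge (bubble_finset_sum_right bubble_wsum_left bubble_wsum_right tadpole_wsum_fst)
open Summit.QuantumFields.BalabanUV.Beta.D1BFx.FineStencilBF (ffOf ffOf_apply biLoc_ffOf)
open Summit.QuantumFields.BalabanUV.Beta.D1BFx.GluonLeg (Ga trK_Ga)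
open Summit.QuantumFields.BalabanUV.Beta.D1BFx.TadpoleParity (tadpole_eq_zero_of_symm)
open Summit.QuantumFields.BalabanUV.Beta.D1BFx.Criticality (tadpole_wsum)
open Summit.QuantumFields.BalabanUV.Beta.D1BFx.LamSectorUnfold (onLat_ffOf_apply abs_onLat_le summable_abs_onLat biLoc_onLat tsum_onLat_mul)

/-! ## §1 The generic Λ-sector as a kernel; localisation of its terms -/

section Lam

variable (n : ℕ) [NeZero n] {a : ℝ} (Λc : Fin 4 → Site 4 → Fin 4 → Site 4 → ℝ) (H : Fin 4 → Site 4 → MKer 4 (Fib 3))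
  {CΛ CH δ : ℝ}

omit [NeZero n] in
/-- [folklore] **THE GENERIC LAGRANGE SECTOR AS A KERNEL**: `ffOf (SLam n Λc H κ u) = −Σ_m wsum (onLat n (Λc m · κ u)) (onLat n (y ↦ ffOf (H m y)))`
(`SLam` with `cwsum = wsum ∘ onLat` unfolded and `ffOf` passed inside; entrywise, no summability). -/
theorem ffOf_SLam_eq_neg_sum_wsum (κ : Fin 4) (u : Site 4) :
    ffOf (SLam n Λc H κ u) = -∑ m : Fin 4, wsum (onLat n (fun y => Λc m y κ u)) (fun v => onLat n (fun y => ffOf (H m y)) v) := by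
  funext x z α β
  simp only [ffOf_apply, SLam, cwsum, wsum, Pi.neg_apply, Finset.sum_apply]
  congr 1
  refine Finset.sum_congr rfl fun m _ => tsum_congr fun v => ?_
  exact congrArg₂ (· * ·) rfl (onLat_ffOf_apply n (fun y => H m y) v x z α β).symm

variable {Λc H}

/-- [folklore] Under (WΛ)(LH) each `m`-term of the generic Λ-sector is localised. -/
theorem loc_wsum_onLat_gen (hCΛ : 0 ≤ CΛ) (hδ : 0 < δ)
    (hΛ : ∀ (m : Fin 4) (y : Site 4) (κ : Fin 4) (u : Site 4), |Λc m y κ u| ≤ CΛ * Real.exp (-δ * l1 ((n : ℤ) • y - u)))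
    (hH : ∀ (m : Fin 4) (y : Site 4), BiLoc (ffOf (H m y)) ((n : ℤ) • y) ((n : ℤ) • y) CH δ) (m κ : Fin 4) (u : Site 4) :
    Loc (wsum (onLat n (fun y => Λc m y κ u)) (fun v => onLat n (fun y => ffOf (H m y)) v)) :=
  ⟨u, u, _, δ / 2, half_pos hδ,
    biLoc_wsum (abs_onLat_le n hCΛ (fun y => hΛ m y κ u)) (biLoc_onLat n ((hH m 0).nonneg (0 : Fin 4)) (hH m)) hδ hCΛ⟩

/-! ## §2 The generic Λ-sector under the fine bubble -/

/-- [folklore] **THE GENERIC LAGRANGE SECTOR IN THE FIRST SLOT OF THE FINE BUBBLE**: for the spread gluon leg `G = Ga n a` and a localised partner `Z`,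
`bubble G (ffOf (SLam n Λc H κ u)) Z = −Σ_m Σ'_y Λc m y κ u · bubble G (ffOf (H m y)) Z`. -/
theorem bubble_SLam_left (hGa : Spr (Ga n a)) (hCΛ : 0 ≤ CΛ) (hδ : 0 < δ)
    (hΛ : ∀ (m : Fin 4) (y : Site 4) (κ : Fin 4) (u : Site 4), |Λc m y κ u| ≤ CΛ * Real.exp (-δ * l1 ((n : ℤ) • y - u)))
    (hH : ∀ (m : Fin 4) (y : Site 4), BiLoc (ffOf (H m y)) ((n : ℤ) • y) ((n : ℤ) • y) CH δ)
    {Z : MKer 4 (Fin 4)} (hZ : Loc Z) (κ : Fin 4) (u : Site 4) :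
    bubble (Ga n a) (ffOf (SLam n Λc H κ u)) Z = -∑ m : Fin 4, ∑' y : Site 4, Λc m y κ u * bubble (Ga n a) (ffOf (H m y)) Z := by
  rw [ffOf_SLam_eq_neg_sum_wsum, ← neg_one_smul ℝ (∑ m : Fin 4, _), bubble_smul_left,
    bubble_finset_sum_left univ hGa (fun m => loc_wsum_onLat_gen n hCΛ hδ hΛ hH m κ u) hZ, neg_one_mul]
  congr 1
  refine Finset.sum_congr rfl fun m _ => ?_
  rw [bubble_wsum_left hGa hZ (summable_abs_onLat n hCΛ hδ (fun y => hΛ m y κ u)) (biLoc_onLat n ((hH m 0).nonneg (0 : Fin 4)) (hH m)) hδ,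
    tsum_onLat_mul]
  exact tsum_congr fun y => by rw [onLat_zsmul]

/-- [folklore] **THE GENERIC LAGRANGE SECTOR IN THE SECOND SLOT OF THE FINE BUBBLE**: for a localised partner `V`,
`bubble G V (ffOf (SLam n Λc H κ u)) = −Σ_m Σ'_y Λc m y κ u · bubble G V (ffOf (H m y))`. -/
theorem bubble_SLam_right (hGa : Spr (Ga n a)) (hCΛ : 0 ≤ CΛ) (hδ : 0 < δ)
    (hΛ : ∀ (m : Fin 4) (y : Site 4) (κ : Fin 4) (u : Site 4), |Λc m y κ u| ≤ CΛ * Real.exp (-δ * l1 ((n : ℤ) • y - u)))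
    (hH : ∀ (m : Fin 4) (y : Site 4), BiLoc (ffOf (H m y)) ((n : ℤ) • y) ((n : ℤ) • y) CH δ)
    {V : MKer 4 (Fin 4)} (hV : Loc V) (κ : Fin 4) (u : Site 4) :
    bubble (Ga n a) V (ffOf (SLam n Λc H κ u)) = -∑ m : Fin 4, ∑' y : Site 4, Λc m y κ u * bubble (Ga n a) V (ffOf (H m y)) := by
  rw [ffOf_SLam_eq_neg_sum_wsum, ← neg_one_smul ℝ (∑ m : Fin 4, _), bubble_smul_right,
    bubble_finset_sum_right univ hGa hV (fun m => loc_wsum_onLat_gen n hCΛ hδ hΛ hH m κ u), neg_one_mul]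
  congr 1
  refine Finset.sum_congr rfl fun m _ => ?_
  rw [bubble_wsum_right hGa hV (summable_abs_onLat n hCΛ hδ (fun y => hΛ m y κ u)) (biLoc_onLat n ((hH m 0).nonneg (0 : Fin 4)) (hH m)) hδ,
    tsum_onLat_mul]
  exact tsum_congr fun y => by rw [onLat_zsmul]

end Lam

/-! ## §3 The Λ₂-slot table under the fine tadpole, generic weights -/

section LamTwo

variable (n : ℕ) [NeZero n] {a : ℝ} {Λc : Fin 4 → Site 4 → Fin 4 → Site 4 → ℝ} {CΛ δ : ℝ}

/-- [folklore] **THE Λ₂-SLOT TABLE IN THE FINE TADPOLE, GENERIC WEIGHTS** — `LamSectorUnfold.tadpole_lamTable_eq` with the straight multiplier response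
`lamCoeffOf (KInv n) n` replaced by any weights `Λc` obeying (WΛ): under the displayed Λ₂ structure
`WΛ κ u l u′ = Σ_m wsum (onLat n (Λc m · l u′)) (onLat n (TΛ m · κ u)) + Σ_m wsum (onLat n (Λc m · κ u)) (onLat n (TΛ m · l u′)) + WA κ u l u′`
(companion tables `TΛ` bi-localised at their coarse bond, `WA` localised and transpose-antisymmetric), for the spread SYMMETRIC gluon leg `G = Ga n a`:
`tadpole G (WΛ κ u l u′) = Σ_m Σ'_y Λc m y l u′ · tadpole G (TΛ m y κ u) + Σ_m Σ'_y Λc m y κ u · tadpole G (TΛ m y l u′)`. -/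
theorem tadpole_lamTable_eq_gen (ha : 0 < a) (hGa : Spr (Ga n a)) (hCΛ : 0 ≤ CΛ) (hδ : 0 < δ)
    (hΛ : ∀ (m : Fin 4) (y : Site 4) (κ : Fin 4) (u : Site 4), |Λc m y κ u| ≤ CΛ * Real.exp (-δ * l1 ((n : ℤ) • y - u)))
    {WΛ : Fin 4 → Site 4 → Fin 4 → Site 4 → MKer 4 (Fin 4)}
    {TΛ : Fin 4 → Site 4 → Fin 4 → Site 4 → MKer 4 (Fin 4)} {WA : Fin 4 → Site 4 → Fin 4 → Site 4 → MKer 4 (Fin 4)} {CT δT : ℝ} (hδT : 0 < δT)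
    (hdec : ∀ κ u l u', WΛ κ u l u' =
      (∑ m : Fin 4, wsum (onLat n (fun y => Λc m y l u')) (fun v => onLat n (fun y => TΛ m y κ u) v))
      + (∑ m : Fin 4, wsum (onLat n (fun y => Λc m y κ u)) (fun v => onLat n (fun y => TΛ m y l u') v))
      + WA κ u l u')
    (hTloc : ∀ m y κ u, BiLoc (TΛ m y κ u) ((n : ℤ) • y) ((n : ℤ) • y) (CT * Real.exp (-δT * l1 ((n : ℤ) • y - u))) δT)
    (hWAa : ∀ κ u l u', trK (WA κ u l u') = -WA κ u l u') (hWAl : ∀ κ u l u', Loc (WA κ u l u'))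
    (κ : Fin 4) (u : Site 4) (l : Fin 4) (u' : Site 4) :
    tadpole (Ga n a) (WΛ κ u l u') =
      (∑ m : Fin 4, ∑' y : Site 4, Λc m y l u' * tadpole (Ga n a) (TΛ m y κ u))
      + ∑ m : Fin 4, ∑' y : Site 4, Λc m y κ u * tadpole (Ga n a) (TΛ m y l u') := by
  have hn : 1 ≤ n := NeZero.one_le
  have hCT : 0 ≤ CT := by
    have h := (hTloc 0 0 0 0).nonneg (0 : Fin 4)
    have hpos : (0 : ℝ) < Real.exp (-δT * l1 ((n : ℤ) • (0 : Site 4) - 0)) := Real.exp_pos _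
    nlinarith
  -- the companion tables with the decay of the amplitude dropped: uniformly bi-localised at the coarse bond
  have hT : ∀ (m : Fin 4) (κ : Fin 4) (u : Site 4) (y : Site 4), BiLoc (TΛ m y κ u) ((n : ℤ) • y) ((n : ℤ) • y) CT δT := by
    intro m κ u y x z a b
    refine (hTloc m y κ u x z a b).trans (mul_le_mul_of_nonneg_right ?_ (Real.exp_pos _).le)
    exact mul_le_of_le_one_right hCT (Real.exp_le_one_iff.2 (by nlinarith [l1_nonneg ((n : ℤ) • y - u)]))
  -- a common rate for the weights and the companion tables, to localise each superposed term
  have hδ₀ : 0 < min δ δT := lt_min hδ hδT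
  have hw₀ : ∀ (m : Fin 4) (y : Site 4) (κ : Fin 4) (u : Site 4),
      |Λc m y κ u| ≤ CΛ * Real.exp (-(min δ δT) * l1 ((n : ℤ) • y - u)) := fun m y κ u =>
    (hΛ m y κ u).trans (mul_le_mul_of_nonneg_left (Real.exp_le_exp.2 (by nlinarith [l1_nonneg ((n : ℤ) • y - u), min_le_left δ δT])) hCΛ)
  have hlocT : ∀ (m κ : Fin 4) (u : Site 4) (l : Fin 4) (u' : Site 4),
      Loc (wsum (onLat n (fun y => Λc m y l u')) (fun v => onLat n (fun y => TΛ m y κ u) v)) :=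
    fun m κ u l u' => ⟨u', u', _, min δ δT / 2, half_pos hδ₀,
      biLoc_wsum (abs_onLat_le n hCΛ (fun y => hw₀ m y l u'))
        (biLoc_onLat n (abs_nonneg CT) (fun y => biLoc_of_le (hT m κ u y) (min_le_right δ δT))) hδ₀ hCΛ⟩
  have h1 : ∀ m : Fin 4, Loc (wsum (onLat n (fun y => Λc m y l u')) (fun v => onLat n (fun y => TΛ m y κ u) v)) :=
    fun m => hlocT m κ u l u'
  have h2 : ∀ m : Fin 4, Loc (wsum (onLat n (fun y => Λc m y κ u)) (fun v => onLat n (fun y => TΛ m y l u') v)) :=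
    fun m => hlocT m l u' κ u
  rw [hdec κ u l u', tadpole_add hGa ((loc_finset_sum univ h1).add (loc_finset_sum univ h2)) (hWAl κ u l u'),
    tadpole_add hGa (loc_finset_sum univ h1) (loc_finset_sum univ h2),
    tadpole_eq_zero_of_symm hGa (trK_Ga n a hn ha) (hWAl κ u l u') (hWAa κ u l u'), add_zero,
    tadpole_finset_sum univ hGa h1, tadpole_finset_sum univ hGa h2]
  congr 1
  · refine Finset.sum_congr rfl fun m _ => ?_
    rw [tadpole_wsum hGa hδ (abs_onLat_le n hCΛ (fun y => hΛ m y l u')) hδT (biLoc_onLat n hCT (hT m κ u)), tsum_onLat_mul]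
    exact tsum_congr fun y => by rw [onLat_zsmul]
  · refine Finset.sum_congr rfl fun m _ => ?_
    rw [tadpole_wsum hGa hδ (abs_onLat_le n hCΛ (fun y => hΛ m y κ u)) hδT (biLoc_onLat n hCT (hT m l u')), tsum_onLat_mul]
    exact tsum_congr fun y => by rw [onLat_zsmul]

end LamTwo


end Summit.QuantumFields.BalabanUV.Beta.D1BFx.LamSectorUnfoldGen

end
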